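import Mathlib.Analysis.SpecialFunctions.Pow.Asymptotics
import Literature.Barriers.PneNP.NaturalProofs
import Literature.Computability.Complexity.PNPNaturalProofsProofs
import Literature.Computability.Complexity.PolyAdvicePH
import HarnessLib

/-!
# The natural-proofs hypothesis is itself `NP ⊄ P/poly`: `HardPRGExist → ¬ (NP ⊆ P/poly)`

The pseudo-randomness hypothesis of the natural proofs barrier (Razborov–Rudich 1997, Thm. 4.1;
tree conjecture `Literature.Barriers.PneNP.HardPRGExist`: a `2^{k^ε}`-hard pseudo-random
generator family `G = (Gₖ : {0,1}ᵏ → {0,1}²ᵏ)` computable in `P/poly`) implies the non-uniform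
lower bound `NP ⊄ P/poly` — the conjecture of the route theses `PneNP/Circuit`, `PneNP/Circuit2`
and, through proved equivalences, of several cruxes of `PneNP/SymmetryBudget`. The docstring of
`HardPRGExist.le_size_of_range` (`NaturalProofs.lean`) records this informally ("so in particular
`NP ⊄ P/poly`"); this file proves it inside the tree's definitions:

* `polyExists_PPoly_subset_PPoly_of_NP_subset_PPoly` — `NP ⊆ P/poly` closes `P/poly` under
  polynomially bounded existential projection, `∃ᵖ·(P/poly) ⊆ P/poly`
  (`∃ᵖ·(P/poly) ⊆ NP/poly ⊆ (P/poly)/poly = P/poly`; the Karp–Lipton advice calculus, all three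
  inclusions being tree theorems of `PolyAdvicePH.lean` / `PolyAdviceClosure.lean`).
* `cktSize_rangeTest`, `exists_rangeTest_circuit` — the polynomial-size `B₂`-circuit
  `Tₖ(y, s) = [Gₖ(s↾k) = y]` on the paired string `⟨y, s⟩`, `|y| = |s| = 2k`.
* `exists_range_circuits_of_NP_subset_PPoly` — under `NP ⊆ P/poly`, the RANGE of a `P/poly`
  generator family, `{y ∈ {0,1}²ᵏ | ∃ s, Gₖ s = y}`, has polynomial-size `B₂`-circuits: the graph
  language `{⟨y, s⟩ | |s| = |y|, T(y, s) = 1}` is in `P/poly = P/poly-advice` (advice `desc Tₖ`,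
  polynomial-time matrix = the circuit evaluator `CircEval.EvalLang` and the length test `LenEq`),
  so the range is in `∃ᵖ·(P/poly) ⊆ P/poly`.
* `eventually_eval_lt_ceil_two_rpow` — a polynomial is eventually `< ⌈2^{k^ε}⌉`.
* `HardPRGExist.not_NP_subset_PPoly` — **the theorem**: by the range test
  (`HardPRGExist.le_size_of_range`: every circuit recognising `range Gₖ` has size `≥ 2^{k^ε}` for
  all large `k`) the polynomial-size range circuits are impossible.

Consequences for the barrier bookkeeping (D-0021): the natural proofs barrier `NaturalProofs` is
CONDITIONAL on `HardPRGExist`, and under that same condition its target `NP ⊄ P/poly` is TRUE —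
the barrier constrains proofs, never the statement (`HardPRGExist.not_NP_subset_PPoly` next to
`NaturalProofs.no_naturalProof_for`). Nothing here is specific to Hamiltonicity or to any route.

## References

* A. A. Razborov, S. Rudich, *Natural proofs*, J. Comput. System Sci. 55 (1997) 24–35, §4
  (definition of `H(Gₖ)` and the remark following it: hardness is at most the circuit size of a
  range recogniser; Thm. 4.1, hypothesis).
* R. M. Karp, R. J. Lipton, *Some connections between nonuniform and uniform complexity
  classes*, STOC 1980, §1 and Thm. 6.1 (advice classes; `NP ⊆ P/poly` collapses).
* S. Arora, B. Barak, *Computational Complexity: A Modern Approach*, CUP 2009, Def. 6.5,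
  Thm. 6.18 (circuit evaluation, `P/poly = P/poly-advice`), §9.2 (pseudo-random generators;
  `P = NP` rules them out), §23.3.
-/

noncomputable section

namespace Literature.Barriers.PneNP

open _root_.Computability Literature.Computability.Complexity Literature.Computability.Complexity.Classes
  Literature.Computability.MetaComplexity Literature.Computability.AlgebraicComplexity Filter Polynomial
  CircEval

/-! ### `NP ⊆ P/poly` closes `P/poly` under `∃ᵖ` -/

/-- **`NP ⊆ P/poly` implies `∃ᵖ·(P/poly) ⊆ P/poly`**: a polynomially bounded existential
projection of a `P/poly` language is again in `P/poly`, since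
`∃ᵖ·(P/poly) ⊆ NP/poly` (`polyExists_PPoly_subset_polyAdvice_NP`, hard-wire the circuits as
advice and guess the witness), `NP/poly ⊆ (P/poly)/poly` (the hypothesis) and
`(P/poly)/poly = P/poly` (`polyAdvice_PPoly_subset_PPoly`). This is the step
`Σₖ₊₁ᵖ ⊆ P/poly` of `PH_subset_PPoly_of_NP_subset_PPoly` isolated as a closure property.
[cite: KarpLipton1980, §1 and Thm. 6.1] -/
theorem polyExists_PPoly_subset_PPoly_of_NP_subset_PPoly (h : Nondeterministic.NP ⊆ PPoly) :
    polyExists PPoly ⊆ PPoly :=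
  calc polyExists PPoly ⊆ polyAdvice Nondeterministic.NP := polyExists_PPoly_subset_polyAdvice_NP
    _ ⊆ polyAdvice PPoly := polyAdvice_mono h
    _ ⊆ PPoly := polyAdvice_PPoly_subset_PPoly

/-! ### The range test circuit `Tₖ(y, s) = [Gₖ(s↾k) = y]` -/

/-- The seed length is at most the output length: `k ≤ 2k`. [folklore] -/
theorem seed_le_output (k : ℕ) : k ≤ 2 * k := by omega

/-- **The range test as a straight-line program.** For a generator family whose output bits have
`B₂`-circuits of size `≤ p(k)`, the test `(y, s) ↦ [∀ i, Gₖ(s↾k)ᵢ = yᵢ]` on `2k + 2k` input bits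
(`y` on the left summand, a padded seed `s` on the right one, of which only the first `k` bits
are read) has a `B₂`-program with `2k·p(k) + 2k + (2k + 1) + 1` gates: the `2k` output circuits
of `Gₖ`, `2k` gates `≠`, a disjunction chain and a negation (Vollmer 1999, §1.2, composition of
straight-line programs; the range recogniser of Razborov–Rudich 1997, §4).
[cite: RazborovRudich1997, §4 (remark after the definition of H(G))] -/
theorem cktSize_rangeTest {G : PRGFamily} {p : Polynomial ℕ}
    (hp : ∀ (k : ℕ) (i : Fin (2 * k)), CktSize B2 (fun s (_ : Unit) => G k s i) (p.eval k))
    (k : ℕ) :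
    CktSize B2 (fun (w : Fin (2 * k) ⊕ Fin (2 * k) → Bool) (_ : Unit) =>
      decide (∀ i : Fin (2 * k),
        G k (fun j : Fin k => w (Sum.inr (Fin.castLE (seed_le_output k) j))) i = w (Sum.inl i)))
      (2 * k * p.eval k + 2 * k + (2 * k + 1) + 1) := by
  -- stage A: the generator on the (first `k` bits of the) seed half, next to a copy of `y`
  have hG : CktSize B2 (fun (s : Fin k → Bool) (i : Fin (2 * k)) => G k s i)
      (Fintype.card (Fin (2 * k)) * p.eval k) :=
    CktSize.pi_const fun i => hp k i
  have hA : CktSize B2 (fun (w : Fin (2 * k) ⊕ Fin (2 * k) → Bool) =>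
      Sum.elim (fun i : Fin (2 * k) =>
          G k (fun j : Fin k => w (Sum.inr (Fin.castLE (seed_le_output k) j))) i)
        (fun i : Fin (2 * k) => w (Sum.inl i))) (2 * k * p.eval k + 0) := by
    have h1 := hG.rewire (ι' := Fin (2 * k) ⊕ Fin (2 * k))
      (fun j : Fin k => Sum.inr (Fin.castLE (seed_le_output k) j))
    have h2 := h1.pair (CktSize.proj B2
      (fun i : Fin (2 * k) => (Sum.inl i : Fin (2 * k) ⊕ Fin (2 * k))))
    exact (h2.of_le (by simp [Fintype.card_fin])).congr fun w i => rfl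
  -- stage B: coordinatewise `≠`
  have hB : CktSize B2 (fun (z : Fin (2 * k) ⊕ Fin (2 * k) → Bool) (i : Fin (2 * k)) =>
      (z (Sum.inl i) != z (Sum.inr i))) (Fintype.card (Fin (2 * k)) * 1) :=
    CktSize.pi_const fun i =>
      (CktSize.gate (B := B2) ⟨2, fun v => (v 0 != v 1)⟩ (show (2 : ℕ) ≤ 2 from le_rfl)
        ![Sum.inl i, Sum.inr i]).congr fun z _ => rfl
  -- stage C: "some coordinate differs", negated
  have hC := (cktSize_anyFin (2 * k)).comp (cktSize_not (ι := Unit) ())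
  have hABC := (hA.comp hB).comp hC
  refine (hABC.of_le ?_).congr fun w _ => ?_
  · simp only [Fintype.card_fin]
    omega
  · simp only [Sum.elim_inl, Sum.elim_inr]
    rw [← decide_not]
    refine decide_eq_decide.mpr ?_
    simp

/-- **The range test circuit on the paired string.** For `G` computable in `P/poly` there are a
polynomial `S` and, for every `k`, a `B₂`-circuit `Tₖ` on the `2(2k) + 2 + 2k` bits of the paired
string `⟨y, s⟩` (`|y| = |s| = 2k`, `pairVec`) of size `≤ S(k)` with
`Tₖ(⟨y, s⟩) = [Gₖ(s↾k) = y]` (read `y` and `s` off the pairing, `pairVec_positions`, and run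
`cktSize_rangeTest`). [cite: RazborovRudich1997, §4 (remark after the definition of H(G))] -/
theorem exists_rangeTest_circuit {G : PRGFamily} (hG : G.IsInPPoly) :
    ∃ S : Polynomial ℕ, ∀ k : ℕ, ∃ C : Circuit (Fin (2 * (2 * k) + 2 + 2 * k)),
      C.IsOver B2 ∧ C.size ≤ S.eval k ∧
        ∀ y s : Fin (2 * k) → Bool, C.eval (pairVec y s) =
          decide (∀ i : Fin (2 * k),
            G k (fun j : Fin k => s (Fin.castLE (seed_le_output k) j)) i = y i) := by
  obtain ⟨p, hp⟩ := cktSize_of_isInPPoly hG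
  refine ⟨2 * X * p + 2 * X + (2 * X + 1) + 1, fun k => ?_⟩
  have hF := cktSize_rangeTest hp k
  have hE := hF.rewire (ι' := Fin (2 * (2 * k) + 2 + 2 * k))
    (Sum.elim (fun i : Fin (2 * k) => Fin.castAdd (2 * k) (Fin.castAdd 2 ⟨2 * (i : ℕ), by omega⟩))
      (fun j : Fin (2 * k) => Fin.natAdd (2 * (2 * k) + 2) j))
  obtain ⟨C, hCB, hCs, hCe⟩ := hE.toCircuit
  refine ⟨C, hCB, hCs.trans (le_of_eq ?_), fun y s => ?_⟩
  · simp only [eval_add, eval_mul, eval_ofNat, eval_X, eval_one]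
  · rw [hCe, pairVec_positions y s]
    exact decide_eq_decide.mpr (by simp only [Sum.elim_inl, Sum.elim_inr])

/-! ### Under `NP ⊆ P/poly` the range of a `P/poly` generator has polynomial-size circuits -/

/-- **Range circuits from `NP ⊆ P/poly`.** If `NP ⊆ P/poly` and the generator family `G` is
computable in `P/poly`, then for some polynomial `q` every range `{y ∈ {0,1}²ᵏ | ∃ s, Gₖ s = y}`
is recognised by a `B₂`-circuit of size `≤ q(k)`. Proof: the graph language
`L' = {⟨y, s⟩ | |s| = |y| ∧ T(⟨y, s⟩) = 1}` (`T` the range test of `exists_rangeTest_circuit`,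
its description `desc T` supplied as advice to the polynomial-time circuit evaluator,
`CircEval.EvalLang ∈ P`, next to the length test `LenEq X ∈ P`) lies in
`P/poly-advice = P/poly` (Arora–Barak Thm. 6.18, `PPoly_eq_polyAdvice_P_holds`); the range is its
projection `{y | ∃ s, |s| ≤ |y| ∧ ⟨y, s⟩ ∈ L'} ∈ ∃ᵖ·(P/poly) ⊆ P/poly`
(`polyExists_PPoly_subset_PPoly_of_NP_subset_PPoly`); a deciding family, evaluated on bit
vectors (`CircuitFamily.Decides.eval_eq`), is the claimed circuit. (Razborov–Rudich 1997, §4: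
the range of `Gₖ` is the `NP/poly`-type set whose circuit size bounds `H(Gₖ)`; Karp–Lipton 1980,
§1, for the advice calculus.) [cite: RazborovRudich1997, §4 (remark after the definition of H(G))] -/
theorem exists_range_circuits_of_NP_subset_PPoly (hNP : Nondeterministic.NP ⊆ PPoly)
    {G : PRGFamily} (hG : G.IsInPPoly) :
    ∃ q : Polynomial ℕ, ∀ k : ℕ, ∃ D : Circuit (Fin (2 * k)),
      D.IsOver B2 ∧ D.size ≤ q.eval k ∧
        ∀ y : Fin (2 * k) → Bool, D.eval y = true ↔ ∃ s, G k s = y := by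
  obtain ⟨S, hS⟩ := exists_rangeTest_circuit hG
  choose C hCB hCs hCe using hS
  have har : ∀ k, ∀ g ∈ (C k).gates, g.arity ≤ 2 := fun k g hg => hCB k g hg
  -- advice: the description of the test circuit, indexed by the total length `6k + 2`
  obtain ⟨a, ha⟩ : ∃ a : ℕ → List Bool, ∀ N, a N = desc (C (N / 6)) := ⟨_, fun _ => rfl⟩
  -- the polynomial-time witness test `V`
  obtain ⟨V, hV, hVmem⟩ : ∃ V : Language Bool, V ∈ Classes.P ∧
      ∀ x v d : List Bool, boolPair (boolPair x v) d ∈ V ↔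
        v.length = x.length ∧ evalFn (boolPair (boolPair x v) d) = [true] := by
    refine ⟨(fstP ⁻¹' LenEq X) ⊓ EvalLang,
      inter_mem_P (preimage_mem_P (LenEq_mem_P X) fstP_mem_FP) EvalLang_mem_P, fun x v d => ?_⟩
    change fstP (boolPair (boolPair x v) d) ∈ LenEq X ∧
      evalFn (boolPair (boolPair x v) d) = [true] ↔ _
    rw [fstP_boolPair, boolPair_mem_LenEq, eval_X]
  -- the graph language `L' ∈ P/poly-advice = P/poly`
  obtain ⟨L', hL'P, hL'mem⟩ : ∃ L' : Language Bool, L' ∈ PPoly ∧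
      ∀ w : List Bool, w ∈ L' ↔ boolPair w (a w.length) ∈ V := by
    refine ⟨{w | boolPair w (a w.length) ∈ V}, ?_, fun w => Iff.rfl⟩
    rw [show PPoly = polyAdvice Classes.P from PPoly_eq_polyAdvice_P_holds]
    refine ⟨V, hV, a, (S + 1) * (8 * ((6 * X + 2) + S) + 10), fun N => ?_, fun w => Iff.rfl⟩
    rw [ha N]
    refine (length_desc_le (C (N / 6))).trans ?_
    have hs : (C (N / 6)).size ≤ S.eval N :=
      (hCs (N / 6)).trans (TM2Iter.eval_mono S (Nat.div_le_self N 6))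
    simp only [eval_mul, eval_add, eval_one, eval_X, eval_ofNat]
    exact Nat.mul_le_mul (by omega) (by omega)
  -- the range language `R ∈ ∃ᵖ·(P/poly) ⊆ P/poly`
  set R : Language Bool :=
    {x | ∃ v : List Bool, v.length ≤ (X : Polynomial ℕ).eval x.length ∧ boolPair x v ∈ L'} with hRdef
  have hR : R ∈ PPoly :=
    polyExists_PPoly_subset_PPoly_of_NP_subset_PPoly hNP ⟨L', hL'P, X, fun x => Iff.rfl⟩
  -- the evaluator on `⟨⟨y, s⟩, advice⟩` for `|y| = |s| = 2k`
  have hev : ∀ (k : ℕ) (y s : Fin (2 * k) → Bool),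
      evalFn (boolPair (boolPair (List.ofFn y) (List.ofFn s))
        (a (boolPair (List.ofFn y) (List.ofFn s)).length)) =
        [decide (∀ i : Fin (2 * k),
          G k (fun j : Fin k => s (Fin.castLE (seed_le_output k) j)) i = y i)] := by
    intro k y s
    have hlen : 2 * (2 * k) + 2 + 2 * k = (boolPair (List.ofFn y) (List.ofFn s)).length := by
      simp only [length_boolPair, List.length_ofFn]
    have hk : (boolPair (List.ofFn y) (List.ofFn s)).length / 6 = k := by
      rw [← hlen]
      omega
    have hadv : a (boolPair (List.ofFn y) (List.ofFn s)).length = desc (C k) := by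
      rw [ha, hk]
    rw [hadv, evalFn_boolPair_desc_cast (C k) (har k) _ hlen]
    have hvec : (fun i : Fin (2 * (2 * k) + 2 + 2 * k) =>
        (boolPair (List.ofFn y) (List.ofFn s)).get (Fin.cast hlen i)) = pairVec y s :=
      get_comp_cast_of_ofFn_eq (ofFn_pairVec y s) hlen
    rw [hvec, hCe]
  -- unpack `R ∈ P/poly` and read off the circuits at length `2k`
  obtain ⟨q, D, hD, hdec⟩ : ∃ q : Polynomial ℕ, ∃ D : CircuitFamily,
      (∀ n, (D n).IsOver B2 ∧ (D n).size ≤ q.eval n) ∧ D.Decides R := by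
    simpa [PPoly, SIZE] using hR
  refine ⟨q.comp (2 * X), fun k => ⟨D (2 * k), (hD _).1, ?_, fun y => ?_⟩⟩
  · rw [eval_comp, eval_mul, eval_ofNat, eval_X]
    exact (hD _).2
  · rw [hdec.eval_eq y, ← Set.mem_iff_boolIndicator]
    change (∃ v : List Bool, v.length ≤ (X : Polynomial ℕ).eval (List.ofFn y).length ∧
      boolPair (List.ofFn y) v ∈ L') ↔ _
    constructor
    · rintro ⟨v, -, hv⟩
      obtain ⟨hvlen, hE⟩ := (hVmem _ _ _).1 ((hL'mem _).1 hv)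
      rw [List.length_ofFn] at hvlen
      obtain ⟨s, rfl⟩ : ∃ s : Fin (2 * k) → Bool, List.ofFn s = v :=
        ⟨fun j => v.get (Fin.cast hvlen.symm j), ofFn_get_cast hvlen.symm⟩
      rw [hev k y s, List.cons.injEq, decide_eq_true_eq] at hE
      exact ⟨_, funext hE.1⟩
    · rintro ⟨s₀, hs₀⟩
      let s : Fin (2 * k) → Bool := fun j => if h : (j : ℕ) < k then s₀ ⟨j, h⟩ else false
      refine ⟨List.ofFn s, by simp [List.length_ofFn, eval_X], ?_⟩
      rw [hL'mem, hVmem, hev k y s, List.cons.injEq, decide_eq_true_eq]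
      refine ⟨by simp only [List.length_ofFn], fun i => ?_, rfl⟩
      have hs : (fun j : Fin k => s (Fin.castLE (seed_le_output k) j)) = s₀ := by
        funext j
        simp [s, j.2]
      rw [hs, hs₀]

/-! ### Growth: a polynomial is eventually below `⌈2^{k^ε}⌉` -/

/-- For a polynomial `q` over `ℕ` and `ε > 0`, eventually `q(k) < ⌈2^{k^ε}⌉₊`: `q(k) < k^c`
eventually (`IsPBounded.eventually_lt_pow`) and `k^c = o(2^{k^ε})` (Mathlib's
`isLittleO_rpow_exp_pos_mul_atTop` along `k ↦ k^ε → ∞`; cf. the copy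
`Literature.Computability.Complexity.eventually_pow_lt_two_rpow_rpow` of `ProofComplexity.lean`,
not imported here to keep the import cone of the barrier catalogue small). [folklore] -/
theorem eventually_eval_lt_ceil_two_rpow (q : Polynomial ℕ) {ε : ℝ} (hε : 0 < ε) :
    ∀ᶠ k : ℕ in atTop, q.eval k < ⌈(2 : ℝ) ^ ((k : ℝ) ^ ε)⌉₊ := by
  have hpb : IsPBounded fun k => q.eval k :=
    (isPBounded_iff_exists_polynomial_holds _).2 ⟨q, fun _ => le_rfl⟩
  obtain ⟨c, hc⟩ := hpb.eventually_lt_pow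
  have hlog : 0 < Real.log 2 := Real.log_pos one_lt_two
  -- `y ^ (c/ε) = o(exp (log 2 * y))`, composed with `y = x ^ ε → ∞` and `x = n → ∞`
  have h1 := (isLittleO_rpow_exp_pos_mul_atTop ((c : ℝ) / ε) hlog).comp_tendsto
    (tendsto_rpow_atTop hε)
  have h2 := h1.comp_tendsto tendsto_natCast_atTop_atTop
  have h3 := h2.bound (c := 1 / 2) (by norm_num)
  filter_upwards [hc, h3] with n hn hn'
  have hn0 : (0 : ℝ) ≤ n := Nat.cast_nonneg n
  have hpow : ((n : ℝ) ^ ε) ^ ((c : ℝ) / ε) = (n : ℝ) ^ c := by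
    rw [← Real.rpow_mul hn0, mul_div_cancel₀ _ hε.ne', Real.rpow_natCast]
  have hexp : Real.exp (Real.log 2 * (n : ℝ) ^ ε) = (2 : ℝ) ^ ((n : ℝ) ^ ε) := by
    rw [Real.rpow_def_of_pos two_pos]
  simp only [Function.comp, hpow, hexp, Real.norm_eq_abs] at hn'
  have hpos : 0 < (2 : ℝ) ^ ((n : ℝ) ^ ε) := Real.rpow_pos_of_pos two_pos _
  rw [abs_of_nonneg (by positivity), abs_of_pos hpos] at hn'
  refine Nat.lt_ceil.2 ?_
  calc ((q.eval n : ℕ) : ℝ) < ((n ^ c : ℕ) : ℝ) := by exact_mod_cast hn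
    _ = (n : ℝ) ^ c := Nat.cast_pow n c
    _ ≤ (2 : ℝ) ^ ((n : ℝ) ^ ε) := by linarith

/-! ### The theorem -/

/-- **`HardPRGExist → NP ⊄ P/poly`: the hypothesis of the natural proofs barrier implies the
non-uniform lower bound it bears on.** If a `2^{k^ε}`-hard pseudo-random generator family
computable in `P/poly` exists (`HardPRGExist`, the hypothesis of Razborov–Rudich 1997, Thm. 4.1)
then `NP ⊄ P/poly`: otherwise the range of `Gₖ` — an `∃`-projection of a `P/poly` graph — would
have polynomial-size circuits (`exists_range_circuits_of_NP_subset_PPoly`), while by the range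
test every circuit recognising `range Gₖ` has size `≥ ⌈2^{k^ε}⌉` for all large `k`
(`HardPRGExist.le_size_of_range`; Razborov–Rudich §4, remark after the definition of `H(G)`:
`H(Gₖ)` is at most the circuit size of the range), and a polynomial is eventually `< ⌈2^{k^ε}⌉`
(`eventually_eval_lt_ceil_two_rpow`). Hence, under the barrier's own hypothesis, its target
statement `NP ⊄ P/poly` is true (and, by `NaturalProofs.no_naturalProof_for`, has no natural
proof): the barrier constrains the PROOF, not the statement. (The uniform shadow "`P = NP` kills
pseudo-random generators" is Arora–Barak 2009, §9.2; the advice calculus is Karp–Lipton 1980.)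
[cite: RazborovRudich1997, §4 (remark after the definition of H(G)) and Thm. 4.1 (hypothesis)] -/
theorem HardPRGExist.not_NP_subset_PPoly (h : HardPRGExist) : ¬ (Nondeterministic.NP ⊆ PPoly) := by
  intro hNP
  obtain ⟨G, hGP, ε, hε, hhard⟩ := h.le_size_of_range
  obtain ⟨q, hq⟩ := exists_range_circuits_of_NP_subset_PPoly hNP hGP
  obtain ⟨k, hk, hlt⟩ := (hhard.and (eventually_eval_lt_ceil_two_rpow q hε)).exists
  obtain ⟨D, hDB, hDs, hDe⟩ := hq k
  have hle := hk D hDB hDe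
  omega

/-- **Corollary: `HardPRGExist` and `NP ⊆ P/poly` are incompatible** — the symmetric reading:
`NP ⊆ P/poly` (e.g. from polynomial-size circuits for `SAT`, or for any `NP`-complete language,
`NP_subset_PPoly_of_isNPHard_of_mem_PPoly`) breaks every candidate hard generator in `P/poly`
(Razborov–Rudich 1997, §4; the "self-defeating" reading of Thm. 4.1).
[cite: RazborovRudich1997, §4 (remark after the definition of H(G)) and Thm. 4.1 (hypothesis)] -/
theorem not_hardPRGExist_of_NP_subset_PPoly (hNP : Nondeterministic.NP ⊆ PPoly) : ¬ HardPRGExist :=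
  fun h => h.not_NP_subset_PPoly hNP

end Literature.Barriers.PneNP

end
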